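import Literature.AlgebraicGeometry.HodgeTheory.FermatLinearCycleGorensteinIdeal
import Mathlib.Algebra.MvPolynomial.PDeriv
import HarnessLib

/-!
# Maclean's quadratic fundamental form at a fake linear cycle (Duque Franco–Villaflor Loyola, ANT 2023, §6)

J. Duque Franco, R. Villaflor Loyola, *On fake linear cycles inside Fermat varieties*, Algebra & Number Theory
**17** (2023) 1847–1865 = arXiv:2112.14818 [DuquefrancoVillaflorloyola2023], §6 "Quadratic fundamental form
and proof of Theorem 1.2" (held text `paper:arxiv-2112.14818`, pp. 13–14). Setting (§4–§5): `Xⁿ_d = {F = 0}`,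
`F = x_0^d + ⋯ + x_{n+1}^d`, the Fermat variety; a fake linear cycle `λ` has
`P_λ = c_λ ∏_{j=1}^{n/2+1} (x_{2j−2}^{d−1} − (c_{2j−2}x_{2j−1})^{d−1})/(x_{2j−2} − c_{2j−2}x_{2j−1})` (plambda),
`J^{F,λ} = ⟨x_{2j−2} − c_{2j−2}x_{2j−1}, x_k^{d−1}⟩` (idealfake) and `T_0 V_λ = J^{F,λ}_d` (Prop. 4.2). Verbatim:

> **Theorem 6.1 (Maclean).** The degree `r := d(n/2+2) − n − 2` piece of the fundamental quadratic form
> `q : Sym²(J^{F,λ}_d) → ⊕_{q=n/2+1}^{n} R^F_{d(q+1)−n−2}/⟨P_λ⟩` is given by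
> `q_r(G,H) = Σ_{i=0}^{n+1} (H ∂Q_i/∂x_i − R_i ∂G/∂x_i)` where `G·P_λ = Σ_i Q_i ∂F/∂x_i` and
> `H·P_λ = Σ_i R_i ∂F/∂x_i`.
>
> **Proposition 6.1.** Let `λ` be a fake linear cycle given by (plambda), and consider
> `G := (x_{2i−2} − c_{2i−2}x_{2i−1})·D ∈ J^{F,λ}_d`. Then
> `q_r(G,G) = (−c_λ/d) ∏_{j≠i} ((x_{2j−2}^{d−1} − (c_{2j−2}x_{2j−1})^{d−1})/(x_{2j−2} − c_{2j−2}x_{2j−1})) · D² · (c_{2i−2}^d + 1)`.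
> *Proof.* Just note that `G·P_λ = c_λ ∏_{j≠i}(…)·D·(x_{2i−2}^{d−1} − (c_{2i−2}x_{2i−1})^{d−1})` hence `Q_j = 0`
> for `j ≠ 2i−2, 2i−1` and `Q_{2i−2} = (c_λ/d) ∏_{j≠i}(…)·D`, `Q_{2i−1} = (−c_λ c_{2i−2}^{d−1}/d) ∏_{j≠i}(…)·D`.
> The result follows now by a direct computation of Maclean's formula. □
>
> *Proof of Theorem 1.2.* After Theorem 1.1 we just need to show that
> `codim V_λ > binom(n/2+d, d) − (n/2+1)²` for all fake linear cycles. In fact, otherwise `V_λ` is smooth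
> and reduced at Fermat, and so the quadratic fundamental form `q = 0` vanishes. In particular its degree `r`
> piece also vanishes `q_r = 0` and so by Proposition 6.1 we conclude that `c_{2i−2}^d + 1 = 0` for all
> `i = 1, …, n/2+1` contrary to the fact that `λ` is a fake linear cycle. □

## What this file PROVES (0 facts, 0 sorry), over any field `K`, at the level of polynomials

Conventions of the tree file `HodgeTheory/FermatLinearCycleGorensteinIdeal.lean` (DFV 2025 Rem. 7.1): the
variables are indexed by `τ ⊕ τ` (`Sum.inl j ↔ x_{2j}`, `Sum.inr j ↔ x_{2j+1}`, `#τ = n/2+1` pairs), `e = d − 1`,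
`P_{λ_j} = fermatLinearCycleFactor c e j`, `P_λ/c_λ = fermatLinearCyclePolynomial c e = ∏_j P_{λ_j}`,
`F = Σ_v x_v^{e+1}`, `J^F = (x_v^e)` (`∂F/∂x_v = (e+1)x_v^e`).

* `macleanForm G H Q R = Σ_v (H ∂_v Q_v − R_v ∂_v G)` — the printed expression of Thm. 6.1;
  `fakeCofactor c e c_λ i = c_λ ∏_{j≠i} P_{λ_j}`; `macleanLift c e c_λ i D` — the printed `Q`'s for
  `G = (x_{2i} − c_i x_{2i+1})·D`: `Q_{2i} = (1/d)·A·D`, `Q_{2i+1} = −(c_i^{d−1}/d)·A·D`, `Q_v = 0` otherwise.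
* `linearForm_mul_mul_fakeP` — "`G·P_λ = c_λ∏_{j≠i}(…)·D·(x_{2i}^{d−1} − (c_{2i}x_{2i+1})^{d−1})`", and
  `linearForm_mul_mul_fakeP_eq_sum_macleanLift` — "`G·P_λ = Σ_i Q_i ∂F/∂x_i`" with these `Q` (needs `d ≠ 0` in `K`).
* `macleanForm_fakeLinearCycle` — **Proposition 6.1, polarised**: for `G = L_i D`, `H = L_i D'` (`L_i = x_{2i} − c_i x_{2i+1}`)
  and the printed lifts, `q_r(G,H) = −((c_i^d + 1)/d)·c_λ ∏_{j≠i} P_{λ_j}·D·D'`; `D' = D` is the statement as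
  printed (`macleanForm_fakeLinearCycle_self`).
* `fakeCofactor_mul_mul_not_mem` — THE STEP THE PRINTED PROOF OF THM. 1.2 LEAVES IMPLICIT ("`q_r = 0` … we
  conclude that `c^d + 1 = 0`" needs the displayed class to be NON-ZERO in `R^F_r/⟨P_λ⟩_r = S_r/(J^F_r + S_d·P_λ)`):
  for `c_λ ≠ 0`, `e ≥ 2` and `(#τ − 1)(e − 1) ≥ 3` — i.e. exactly the paper's standing hypothesis
  `d ≥ 2 + 6/n` — there are monomials `D, D'` of degree `e` (`= d − 1`, so `G, H ∈ S_d`) with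
  `c_λ ∏_{j≠i} P_{λ_j} · D · D' ∉ J^F + (P_λ)`; witness functional
  `Φ(H) = coeff_{∏ x_v^{e−1}}(L_i · Z · H)` (it kills `J^F` and `P_λ·S` because `L_i P_{λ_i} = x_{2i}^e − c_i^e x_{2i+1}^e ∈ J^F`),
  `D = x_{2i}^{e−2}·x^{μ₁}`, `D' = x_{2i+1}^{e−1}·x^{μ₂}` with `x^{μ₁}x^{μ₂}·Z = ∏_{j≠i} x_{2j+1}^{e−1}`, and
  `coeff(∏_{j≠i} P_{λ_j} x_{2j+1}^{e−1}) = 1` at `∏_{j≠i} (x_{2j}x_{2j+1})^{e−1}` (no hypothesis on the `c_j`).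
  Hence `macleanForm_fakeLinearCycle_not_mem` (the value of Prop. 6.1 is non-zero in `S/(J^F + (P_λ))` when
  `c_i^d + 1 ≠ 0`) and `pow_eq_neg_one_of_forall_macleanForm_mem`: **if `q_r(L_i D, L_i D') ≡ 0 mod J^F + (P_λ)`
  for all forms `D, D'` of degree `d − 1` then `c_i^d = −1`** — the algebraic content of "`V_λ` smooth and reduced
  at Fermat ⇒ `λ` is a genuine linear cycle", i.e. (with Thm. 6.1) fake linear cycles have NON-REDUCED Hodge loci.

NOT formalised (cited transcendental/deformation-theoretic input, no fact minted): Maclean's Theorem 6.1 itself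
(that `q_r` computed with ANY lifts `Q, R` is the degree-`r` piece of the second fundamental form of `V_λ`, and
that `q = 0` when `V_λ` is smooth of dimension `dim T_0V_λ`) [Maclean 2005, Asian J. Math. 9]; Prop. 4.2
(`T_0V_λ = J^{F,λ}_d`); the residue description of `λ` (plambda).
-/

noncomputable section

open MvPolynomial Finset Literature.AlgebraicGeometry.HodgeTheory

namespace Literature.AlgebraicGeometry.DuqueFrancoVillaflor2023

variable {K : Type*} [Field K] {τ : Type*}

/-! ## The printed objects -/

section Defs

variable (c : τ → K) (e : ℕ) (cP : K) (i : τ)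

/-- `A := c_λ ∏_{j ≠ i} P_{λ_j}` — the product over the OTHER pairs in Prop. 6.1 (`P_{λ_j}` = tree
`fermatLinearCycleFactor c e j = Σ_{l<e} x_{2j}^l (c_j x_{2j+1})^{e−1−l}`, `e = d − 1`).
[cite: DuquefrancoVillaflorloyola2023, Proposition 6.1] -/
def fakeCofactor [Fintype τ] [DecidableEq τ] : MvPolynomial (τ ⊕ τ) K :=
  C cP * ∏ j ∈ univ.erase i, fermatLinearCycleFactor c e j

/-- The printed lifts for `G = (x_{2i} − c_i x_{2i+1})·D`: `Q_{2i} = (c_λ/d)∏_{j≠i}(…)·D = (1/d)·A·D`,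
`Q_{2i+1} = −(c_λ c_i^{d−1}/d)∏_{j≠i}(…)·D = −(c_i^{e}/d)·A·D`, `Q_v = 0` otherwise (`d = e + 1`).
[cite: DuquefrancoVillaflorloyola2023, Proposition 6.1 (proof)] -/
def macleanLift [Fintype τ] [DecidableEq τ] (D : MvPolynomial (τ ⊕ τ) K) (v : τ ⊕ τ) : MvPolynomial (τ ⊕ τ) K :=
  if v = Sum.inl i then C (1 / ((e + 1 : ℕ) : K)) * fakeCofactor c e cP i * D
  else if v = Sum.inr i then -(C (c i ^ e / ((e + 1 : ℕ) : K)) * fakeCofactor c e cP i * D)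
  else 0

end Defs

/-- **Maclean's degree-`r` piece** `q_r(G,H) = Σ_v (H·∂Q_v/∂x_v − R_v·∂G/∂x_v)`, for lifts `Q, R` with
`G·P_λ = Σ Q_v ∂F/∂x_v`, `H·P_λ = Σ R_v ∂F/∂x_v` — the printed expression, as a polynomial (its class in
`R^F_r/⟨P_λ⟩` is the invariant). [cite: DuquefrancoVillaflorloyola2023, Theorem 6.1 (Maclean)] -/
def macleanForm {σ : Type*} [Fintype σ] (G H : MvPolynomial σ K) (Q R : σ → MvPolynomial σ K) :
    MvPolynomial σ K :=
  ∑ v, (H * pderiv v (Q v) - R v * pderiv v G)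

variable [Fintype τ] [DecidableEq τ] (c : τ → K) (e : ℕ) (cP : K) (i : τ)

/-! ## Derivatives -/

omit [DecidableEq τ] in
/-- `∂F/∂x_v = (e+1)·x_v^e` for `F = Σ_w x_w^{e+1}` (`e + 1 = d`). [cite: DuquefrancoVillaflorloyola2023, Definition 4.2] -/
theorem pderiv_fermatSum (v : τ ⊕ τ) :
    pderiv v (∑ w : τ ⊕ τ, (X w : MvPolynomial (τ ⊕ τ) K) ^ (e + 1)) =
      C (((e + 1 : ℕ) : K)) * X v ^ e := by
  rw [map_sum, Finset.sum_eq_single v]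
  · rw [pderiv_pow, pderiv_X_self, mul_one, Nat.add_sub_cancel, map_natCast]
  · intro w _ hw
    rw [pderiv_pow, pderiv_X_of_ne hw, mul_zero]
  · intro h; exact absurd (Finset.mem_univ v) h

omit [Fintype τ] [DecidableEq τ] in
/-- A derivation killing every factor kills the product. [folklore] -/
private theorem pderiv_prod_eq_zero {ι : Type*} (s : Finset ι) (f : ι → MvPolynomial (τ ⊕ τ) K) (v : τ ⊕ τ)
    (h : ∀ j ∈ s, pderiv v (f j) = 0) : pderiv v (∏ j ∈ s, f j) = 0 := by
  classical
  induction s using Finset.induction_on with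
  | empty => simp
  | insert a s ha ih =>
    rw [Finset.prod_insert ha, pderiv_mul, h a (Finset.mem_insert_self a s),
      ih fun j hj => h j (Finset.mem_insert_of_mem hj), zero_mul, mul_zero, add_zero]

omit [Fintype τ] [DecidableEq τ] in
/-- `P_{λ_j}` involves only `x_{2j}, x_{2j+1}`: `∂P_{λ_j}/∂x_v = 0` for `v ∉ {2j, 2j+1}`.
[cite: DuquefrancoVillaflorloyola2023, Proposition 6.1 (proof)] -/
theorem pderiv_fermatLinearCycleFactor_eq_zero (j : τ) (v : τ ⊕ τ) (h1 : v ≠ Sum.inl j) (h2 : v ≠ Sum.inr j) :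
    pderiv v (fermatLinearCycleFactor c e j) = 0 := by
  unfold fermatLinearCycleFactor
  rw [map_sum]
  refine Finset.sum_eq_zero fun l _ => ?_
  rw [pderiv_mul, pderiv_pow, pderiv_pow, pderiv_C_mul, pderiv_X_of_ne h1.symm, pderiv_X_of_ne h2.symm]
  simp

/-- `A = c_λ∏_{j≠i} P_{λ_j}` does not involve `x_{2i}`: `∂A/∂x_{2i} = 0`.
[cite: DuquefrancoVillaflorloyola2023, Proposition 6.1 (proof)] -/
theorem pderiv_inl_fakeCofactor : pderiv (Sum.inl i) (fakeCofactor c e cP i) = 0 := by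
  rw [fakeCofactor, pderiv_C_mul, pderiv_prod_eq_zero, mul_zero]
  intro j hj
  exact pderiv_fermatLinearCycleFactor_eq_zero c e j _
    (fun h => (Finset.mem_erase.mp hj).1 (Sum.inl_injective h).symm) Sum.inl_ne_inr

/-- … nor `x_{2i+1}`: `∂A/∂x_{2i+1} = 0`. [cite: DuquefrancoVillaflorloyola2023, Proposition 6.1 (proof)] -/
theorem pderiv_inr_fakeCofactor : pderiv (Sum.inr i) (fakeCofactor c e cP i) = 0 := by
  rw [fakeCofactor, pderiv_C_mul, pderiv_prod_eq_zero, mul_zero]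
  intro j hj
  exact pderiv_fermatLinearCycleFactor_eq_zero c e j _ Sum.inr_ne_inl
    (fun h => (Finset.mem_erase.mp hj).1 (Sum.inr_injective h).symm)

/-! ## `G·P_λ = Σ_v Q_v ∂F/∂x_v` with the printed `Q` -/

/-- `P_λ/c_λ = P_{λ_i} · ∏_{j≠i} P_{λ_j}`. [cite: DuquefrancoVillaflorloyola2023, Proposition 6.1 (proof)] -/
theorem fermatLinearCyclePolynomial_eq_mul_prod_erase :
    fermatLinearCyclePolynomial c e = fermatLinearCycleFactor c e i * ∏ j ∈ univ.erase i, fermatLinearCycleFactor c e j := by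
  rw [fermatLinearCyclePolynomial, Finset.mul_prod_erase _ _ (Finset.mem_univ i)]

/-- "`G·P_λ = c_λ∏_{j≠i}(…)·D·(x_{2i}^{d−1} − (c_{2i}x_{2i+1})^{d−1})`": for `G = (x_{2i} − c_i x_{2i+1})·D`,
`G·P_λ = A·D·(x_{2i}^e − c_i^e x_{2i+1}^e)`. [cite: DuquefrancoVillaflorloyola2023, Proposition 6.1 (proof)] -/
theorem linearForm_mul_mul_fakeP (D : MvPolynomial (τ ⊕ τ) K) :
    ((X (Sum.inl i) - C (c i) * X (Sum.inr i)) * D) * (C cP * fermatLinearCyclePolynomial c e) =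
      fakeCofactor c e cP i * D * (X (Sum.inl i) ^ e - C (c i ^ e) * X (Sum.inr i) ^ e) := by
  rw [fermatLinearCyclePolynomial_eq_mul_prod_erase c e i, fakeCofactor]
  have h := X_sub_C_mul_X_mul_fermatLinearCycleFactor c e i
  rw [mul_pow, ← map_pow] at h
  linear_combination (C cP * (∏ j ∈ univ.erase i, fermatLinearCycleFactor c e j) * D) * h

/-- `Q_{2i} = (1/d)·A·D`. [cite: DuquefrancoVillaflorloyola2023, Proposition 6.1 (proof)] -/
theorem macleanLift_inl (D : MvPolynomial (τ ⊕ τ) K) :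
    macleanLift c e cP i D (Sum.inl i) = C (1 / ((e + 1 : ℕ) : K)) * fakeCofactor c e cP i * D := by
  simp [macleanLift]

/-- `Q_{2i+1} = −(c_i^e/d)·A·D`. [cite: DuquefrancoVillaflorloyola2023, Proposition 6.1 (proof)] -/
theorem macleanLift_inr (D : MvPolynomial (τ ⊕ τ) K) :
    macleanLift c e cP i D (Sum.inr i) = -(C (c i ^ e / ((e + 1 : ℕ) : K)) * fakeCofactor c e cP i * D) := by
  simp [macleanLift]

/-- `Q_v = 0` off the pair `i`. [cite: DuquefrancoVillaflorloyola2023, Proposition 6.1 (proof)] -/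
theorem macleanLift_of_ne (D : MvPolynomial (τ ⊕ τ) K) {v : τ ⊕ τ} (h1 : v ≠ Sum.inl i) (h2 : v ≠ Sum.inr i) :
    macleanLift c e cP i D v = 0 := by
  simp [macleanLift, h1, h2]

/-- **"hence `Q_j = 0` for `j ≠ 2i−2, 2i−1` and `Q_{2i−2} = (c_λ/d)∏(…)D`, `Q_{2i−1} = −(c_λc^{d−1}/d)∏(…)D`":
with the printed lifts, `G·P_λ = Σ_v Q_v ∂F/∂x_v`** (`d = e+1` invertible in `K`).
[cite: DuquefrancoVillaflorloyola2023, Proposition 6.1 (proof)] -/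
theorem linearForm_mul_mul_fakeP_eq_sum_macleanLift (D : MvPolynomial (τ ⊕ τ) K) (hd : ((e + 1 : ℕ) : K) ≠ 0) :
    ((X (Sum.inl i) - C (c i) * X (Sum.inr i)) * D) * (C cP * fermatLinearCyclePolynomial c e) =
      ∑ v, macleanLift c e cP i D v * pderiv v (∑ w : τ ⊕ τ, (X w : MvPolynomial (τ ⊕ τ) K) ^ (e + 1)) := by
  rw [Finset.sum_eq_add_of_mem (Sum.inl i) (Sum.inr i) (Finset.mem_univ _) (Finset.mem_univ _) Sum.inl_ne_inr]
  · rw [pderiv_fermatSum, pderiv_fermatSum, linearForm_mul_mul_fakeP, macleanLift_inl, macleanLift_inr]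
    have h1 : C (1 / ((e + 1 : ℕ) : K)) * C (((e + 1 : ℕ) : K)) = (1 : MvPolynomial (τ ⊕ τ) K) := by
      rw [← map_mul, div_mul_cancel₀ _ hd, map_one]
    have h2 : C (c i ^ e / ((e + 1 : ℕ) : K)) * C (((e + 1 : ℕ) : K)) = (C (c i ^ e) : MvPolynomial (τ ⊕ τ) K) := by
      rw [← map_mul, div_mul_cancel₀ _ hd]
    linear_combination (-(fakeCofactor c e cP i * D * X (Sum.inl i) ^ e)) * h1 +
      (fakeCofactor c e cP i * D * X (Sum.inr i) ^ e) * h2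
  · intro v _ hv
    rw [macleanLift_of_ne c e cP i D hv.1 hv.2, zero_mul]

/-! ## Proposition 6.1 -/

omit [Fintype τ] [DecidableEq τ] in
/-- `∂L_i/∂x_{2i} = 1` for `L_i = x_{2i} − c_i x_{2i+1}`. [cite: DuquefrancoVillaflorloyola2023, Proposition 6.1 (proof)] -/
theorem pderiv_inl_linearForm :
    pderiv (Sum.inl i) ((X (Sum.inl i) : MvPolynomial (τ ⊕ τ) K) - C (c i) * X (Sum.inr i)) = 1 := by
  rw [map_sub, pderiv_X_self, pderiv_C_mul, pderiv_X_of_ne Sum.inr_ne_inl, mul_zero, sub_zero]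

omit [Fintype τ] [DecidableEq τ] in
/-- `∂L_i/∂x_{2i+1} = −c_i`. [cite: DuquefrancoVillaflorloyola2023, Proposition 6.1 (proof)] -/
theorem pderiv_inr_linearForm :
    pderiv (Sum.inr i) ((X (Sum.inl i) : MvPolynomial (τ ⊕ τ) K) - C (c i) * X (Sum.inr i)) = -C (c i) := by
  rw [map_sub, pderiv_X_of_ne Sum.inl_ne_inr, pderiv_C_mul, pderiv_X_self, mul_one, zero_sub]

/-- **Proposition 6.1 (polarised form).** For `G = L_i·D`, `H = L_i·D'` (`L_i = x_{2i} − c_i x_{2i+1}`) and the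
printed lifts `Q = macleanLift … D`, `R = macleanLift … D'`:
`q_r(G,H) = Σ_v (H ∂_vQ_v − R_v ∂_vG) = −((c_i^{e+1} + 1)/(e+1)) · c_λ∏_{j≠i}P_{λ_j} · D · D'` (`d = e + 1`).
[cite: DuquefrancoVillaflorloyola2023, Proposition 6.1] -/
theorem macleanForm_fakeLinearCycle (D D' : MvPolynomial (τ ⊕ τ) K) :
    macleanForm ((X (Sum.inl i) - C (c i) * X (Sum.inr i)) * D) ((X (Sum.inl i) - C (c i) * X (Sum.inr i)) * D')
        (macleanLift c e cP i D) (macleanLift c e cP i D') =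
      -C ((c i ^ (e + 1) + 1) / ((e + 1 : ℕ) : K)) * (fakeCofactor c e cP i * D * D') := by
  rw [macleanForm,
    Finset.sum_eq_add_of_mem (Sum.inl i) (Sum.inr i) (Finset.mem_univ _) (Finset.mem_univ _) Sum.inl_ne_inr]
  · -- the two surviving terms
    have hA1 := pderiv_inl_fakeCofactor c e cP i
    have hA2 := pderiv_inr_fakeCofactor c e cP i
    have hQ1 : pderiv (Sum.inl i) (macleanLift c e cP i D (Sum.inl i)) =
        C (1 / ((e + 1 : ℕ) : K)) * fakeCofactor c e cP i * pderiv (Sum.inl i) D := by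
      rw [macleanLift_inl, mul_assoc, pderiv_C_mul, pderiv_mul, hA1, zero_mul, zero_add, ← mul_assoc]
    have hQ2 : pderiv (Sum.inr i) (macleanLift c e cP i D (Sum.inr i)) =
        -(C (c i ^ e / ((e + 1 : ℕ) : K)) * fakeCofactor c e cP i * pderiv (Sum.inr i) D) := by
      rw [macleanLift_inr, map_neg, mul_assoc, pderiv_C_mul, pderiv_mul, hA2, zero_mul, zero_add, ← mul_assoc]
    have hG1 : pderiv (Sum.inl i) (((X (Sum.inl i) : MvPolynomial (τ ⊕ τ) K) - C (c i) * X (Sum.inr i)) * D) =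
        D + ((X (Sum.inl i) : MvPolynomial (τ ⊕ τ) K) - C (c i) * X (Sum.inr i)) * pderiv (Sum.inl i) D := by
      rw [pderiv_mul, pderiv_inl_linearForm, one_mul]
    have hG2 : pderiv (Sum.inr i) (((X (Sum.inl i) : MvPolynomial (τ ⊕ τ) K) - C (c i) * X (Sum.inr i)) * D) =
        -C (c i) * D + ((X (Sum.inl i) : MvPolynomial (τ ⊕ τ) K) - C (c i) * X (Sum.inr i)) * pderiv (Sum.inr i) D := by
      rw [pderiv_mul, pderiv_inr_linearForm]
    rw [hQ1, hQ2, hG1, hG2, macleanLift_inl, macleanLift_inr]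
    have hs : C ((c i ^ (e + 1) + 1) / ((e + 1 : ℕ) : K)) =
        (C (1 / ((e + 1 : ℕ) : K)) + C (c i ^ e / ((e + 1 : ℕ) : K)) * C (c i) : MvPolynomial (τ ⊕ τ) K) := by
      rw [← map_mul, ← map_add]
      congr 1
      rw [pow_succ]
      ring
    rw [hs]
    ring
  · intro v _ hv
    rw [macleanLift_of_ne c e cP i D hv.1 hv.2, macleanLift_of_ne c e cP i D' hv.1 hv.2, map_zero, mul_zero,
      zero_mul, sub_zero]

/-- **Proposition 6.1 as printed** (`H = G`): `q_r(G,G) = −(c_λ/d)·∏_{j≠i}P_{λ_j}·D²·(c_i^d + 1)`, `d = e + 1`.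
[cite: DuquefrancoVillaflorloyola2023, Proposition 6.1] -/
theorem macleanForm_fakeLinearCycle_self (D : MvPolynomial (τ ⊕ τ) K) :
    macleanForm ((X (Sum.inl i) - C (c i) * X (Sum.inr i)) * D) ((X (Sum.inl i) - C (c i) * X (Sum.inr i)) * D)
        (macleanLift c e cP i D) (macleanLift c e cP i D) =
      -C (cP / ((e + 1 : ℕ) : K)) * (∏ j ∈ univ.erase i, fermatLinearCycleFactor c e j) * D ^ 2 *
        C (c i ^ (e + 1) + 1) := by
  rw [macleanForm_fakeLinearCycle, fakeCofactor]
  have : C ((c i ^ (e + 1) + 1) / ((e + 1 : ℕ) : K)) * C cP =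
      (C (cP / ((e + 1 : ℕ) : K)) * C (c i ^ (e + 1) + 1) : MvPolynomial (τ ⊕ τ) K) := by
    rw [← map_mul, ← map_mul]; congr 1; ring
  linear_combination (-((∏ j ∈ univ.erase i, fermatLinearCycleFactor c e j) * D ^ 2)) * this

/-! ## The non-vanishing of the class of `q_r(G,H)` in `S/(J^F + (P_λ))` -/

/-- The target exponent on a set `s` of pairs: `e − 1` on `x_{2j}, x_{2j+1}` for `j ∈ s`, `0` elsewhere. [folklore] -/
private def pairTarget (e : ℕ) (s : Finset τ) : (τ ⊕ τ) →₀ ℕ :=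
  ∑ j ∈ s, (Finsupp.single (Sum.inl j) (e - 1) + Finsupp.single (Sum.inr j) (e - 1))

/-- The odd-variable weight `Σ_{j∈s} (e−1)·[x_{2j+1}]`. [folklore] -/
private def inrWeight (e : ℕ) (s : Finset τ) : (τ ⊕ τ) →₀ ℕ :=
  ∑ j ∈ s, Finsupp.single (Sum.inr j) (e - 1)

omit [Fintype τ] in
/-- Value of the target exponent at `x_{2j}`. [folklore] -/
private theorem pairTarget_apply_inl (s : Finset τ) (j : τ) :
    pairTarget e s (Sum.inl j) = if j ∈ s then e - 1 else 0 := by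
  simp only [pairTarget, Finset.sum_apply', Finsupp.add_apply, Finsupp.single_apply, Sum.inl.injEq,
    reduceCtorEq, if_false, add_zero]
  rw [Finset.sum_ite_eq']

omit [Fintype τ] in
/-- Value of the target exponent at `x_{2j+1}`. [folklore] -/
private theorem pairTarget_apply_inr (s : Finset τ) (j : τ) :
    pairTarget e s (Sum.inr j) = if j ∈ s then e - 1 else 0 := by
  simp only [pairTarget, Finset.sum_apply', Finsupp.add_apply, Finsupp.single_apply, Sum.inr.injEq,
    reduceCtorEq, if_false, zero_add]
  rw [Finset.sum_ite_eq']

omit [Fintype τ] [DecidableEq τ] in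
/-- The odd weight vanishes at `x_{2j}`. [folklore] -/
private theorem inrWeight_apply_inl (s : Finset τ) (j : τ) : inrWeight e s (Sum.inl j) = 0 := by
  simp [inrWeight, Finset.sum_apply']

omit [Fintype τ] in
/-- Value of the odd weight at `x_{2j+1}`. [folklore] -/
private theorem inrWeight_apply_inr (s : Finset τ) (j : τ) :
    inrWeight e s (Sum.inr j) = if j ∈ s then e - 1 else 0 := by
  simp only [inrWeight, Finset.sum_apply', Finsupp.single_apply, Sum.inr.injEq]
  rw [Finset.sum_ite_eq']

omit [Fintype τ] [DecidableEq τ] in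
/-- `P_{λ_j}·x_{2j+1}^{e−1} = Σ_{l<e} c_j^{e−1−l} x_{2j}^l x_{2j+1}^{2e−2−l}` (monomial form).
[cite: DuquefrancoVillaflorloyola2023, Theorem 1.1, eq. (plambda)] -/
theorem fermatLinearCycleFactor_mul_X_pow (j : τ) :
    fermatLinearCycleFactor c e j * X (Sum.inr j) ^ (e - 1) =
      ∑ l ∈ range e, monomial (Finsupp.single (Sum.inl j) l + Finsupp.single (Sum.inr j) (2 * e - 2 - l))
        (c j ^ (e - 1 - l)) := by
  rw [fermatLinearCycleFactor, Finset.sum_mul]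
  refine Finset.sum_congr rfl fun l hl => ?_
  rw [Finset.mem_range] at hl
  rw [mul_pow, ← map_pow, X_pow_eq_monomial, X_pow_eq_monomial, X_pow_eq_monomial, C_mul_monomial, monomial_mul,
    monomial_mul, add_assoc, ← Finsupp.single_add, show e - 1 - l + (e - 1) = 2 * e - 2 - l by omega]
  congr 1
  ring

omit [Fintype τ] in
/-- The leading-term count: the coefficient of `∏_{j∈s}(x_{2j}x_{2j+1})^{e−1}` in `∏_{j∈s} P_{λ_j}·x_{2j+1}^{e−1}`
is `1` — from each factor only the term `l = e−1`, i.e. `x_{2j}^{e−1}·x_{2j+1}^{e−1}` (coefficient `c_j^0 = 1`),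
can contribute. [cite: DuquefrancoVillaflorloyola2023, Theorem 1.2 (proof)] -/
theorem coeff_pairTarget_prod (he : 1 ≤ e) (s : Finset τ) :
    coeff (pairTarget e s) (∏ j ∈ s, fermatLinearCycleFactor c e j * X (Sum.inr j) ^ (e - 1)) = 1 := by
  induction s using Finset.induction_on with
  | empty => simp [pairTarget]
  | insert a s ha ih =>
    rw [Finset.prod_insert ha, fermatLinearCycleFactor_mul_X_pow, Finset.sum_mul, coeff_sum,
      Finset.sum_eq_single (e - 1)]
    · -- the term `l = e − 1`
      rw [coeff_monomial_mul', if_pos, show e - 1 - (e - 1) = 0 from Nat.sub_self _, pow_zero, one_mul]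
      · have : pairTarget e (insert a s) - (Finsupp.single (Sum.inl a) (e - 1) + Finsupp.single (Sum.inr a) (2 * e - 2 - (e - 1))) =
            pairTarget e s := by
          rw [show 2 * e - 2 - (e - 1) = e - 1 by omega, pairTarget, Finset.sum_insert ha, add_tsub_cancel_left,
            pairTarget]
        rw [this, ih]
      · rw [show 2 * e - 2 - (e - 1) = e - 1 by omega, pairTarget, Finset.sum_insert ha]
        exact le_self_add
    · -- the terms `l < e − 1` do not fit under the target at `x_{2a+1}`
      intro l hl hne
      rw [Finset.mem_range] at hl
      rw [coeff_monomial_mul', if_neg]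
      intro hle
      have := hle (Sum.inr a)
      simp only [Finsupp.add_apply, Finsupp.single_apply, reduceCtorEq, ↓reduceIte, zero_add,
        pairTarget_apply_inr, Finset.mem_insert_self] at this
      omega
    · intro h
      exact absurd (Finset.mem_range.mpr (by omega)) h

omit [Fintype τ] [DecidableEq τ] in
/-- `∏_{j∈s} x_{2j+1}^{e−1} · ∏_{j∈s} P_{λ_j} = ∏_{j∈s} P_{λ_j} x_{2j+1}^{e−1}` with the left factor as one monomial.
[folklore] -/
private theorem monomial_inrWeight_mul_prod (s : Finset τ) :
    monomial (inrWeight e s) (1 : K) * ∏ j ∈ s, fermatLinearCycleFactor c e j =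
      ∏ j ∈ s, fermatLinearCycleFactor c e j * X (Sum.inr j) ^ (e - 1) := by
  rw [inrWeight, monomial_sum_one, ← Finset.prod_mul_distrib]
  refine Finset.prod_congr rfl fun j _ => ?_
  rw [X_pow_eq_monomial, mul_comm]

/-- The socle exponent splits as pair `i` plus the other pairs. [folklore] -/
private theorem fermatSocleExponent_sub_pair :
    fermatSocleExponent (τ ⊕ τ) e - (Finsupp.single (Sum.inl i) (e - 1) + Finsupp.single (Sum.inr i) (e - 1)) =
      pairTarget e (univ.erase i) := by
  ext v
  rw [Finsupp.tsub_apply, Finsupp.add_apply, fermatSocleExponent_apply]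
  rcases v with j | j
  · rw [pairTarget_apply_inl]
    simp only [Finsupp.single_apply, Sum.inl.injEq, reduceCtorEq, ↓reduceIte, add_zero, Finset.mem_erase,
      Finset.mem_univ, and_true]
    by_cases h : i = j
    · subst h; simp
    · rw [if_neg h, if_pos (Ne.symm h)]; omega
  · rw [pairTarget_apply_inr]
    simp only [Finsupp.single_apply, Sum.inr.injEq, reduceCtorEq, ↓reduceIte, zero_add, Finset.mem_erase,
      Finset.mem_univ, and_true]
    by_cases h : i = j
    · subst h; simp
    · rw [if_neg h, if_pos (Ne.symm h)]; omega

omit [DecidableEq τ] in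
/-- The witness functional `Φ(H) = coeff_{∏x_v^{e−1}}(L_i·Z·H)` kills `J^F = (x_v^e)`.
[cite: DuquefrancoVillaflorloyola2023, Theorem 1.2 (proof)] -/
theorem socle_linearForm_mul_eq_zero_of_mem_span (he : 1 ≤ e) (Z H : MvPolynomial (τ ⊕ τ) K)
    (hH : H ∈ Ideal.span (Set.range fun v : τ ⊕ τ => (X v : MvPolynomial (τ ⊕ τ) K) ^ e)) :
    fermatSocleFunctional K (τ ⊕ τ) e ((X (Sum.inl i) - C (c i) * X (Sum.inr i)) * Z * H) = 0 :=
  fermatSocleFunctional_eq_zero_of_mem he (Ideal.mul_mem_left _ _ hH)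

/-- … and kills every multiple of `P_λ`, because `L_i·P_{λ_i} = x_{2i}^e − c_i^e x_{2i+1}^e ∈ J^F`.
[cite: DuquefrancoVillaflorloyola2023, Theorem 1.2 (proof)] -/
theorem socle_linearForm_mul_eq_zero_of_mul_fakeP (he : 1 ≤ e) (Z B : MvPolynomial (τ ⊕ τ) K) :
    fermatSocleFunctional K (τ ⊕ τ) e
      ((X (Sum.inl i) - C (c i) * X (Sum.inr i)) * Z * (B * (C cP * fermatLinearCyclePolynomial c e))) = 0 := by
  apply fermatSocleFunctional_eq_zero_of_mem he
  have hmem : (X (Sum.inl i) : MvPolynomial (τ ⊕ τ) K) ^ e - C (c i ^ e) * X (Sum.inr i) ^ e ∈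
      Ideal.span (Set.range fun v : τ ⊕ τ => (X v : MvPolynomial (τ ⊕ τ) K) ^ e) :=
    Ideal.sub_mem _ (Ideal.subset_span ⟨Sum.inl i, rfl⟩)
      (Ideal.mul_mem_left _ _ (Ideal.subset_span ⟨Sum.inr i, rfl⟩))
  have h := X_sub_C_mul_X_mul_fermatLinearCycleFactor c e i
  rw [mul_pow, ← map_pow] at h
  have : (X (Sum.inl i) - C (c i) * X (Sum.inr i)) * Z * (B * (C cP * fermatLinearCyclePolynomial c e)) =
      (Z * B * C cP * ∏ j ∈ univ.erase i, fermatLinearCycleFactor c e j) *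
        ((X (Sum.inl i) : MvPolynomial (τ ⊕ τ) K) ^ e - C (c i ^ e) * X (Sum.inr i) ^ e) := by
    rw [fermatLinearCyclePolynomial_eq_mul_prod_erase c e i, ← h]; ring
  rw [this]
  exact Ideal.mul_mem_left _ _ hmem

/-- Hence `Φ` kills `J^F + (P_λ)`. [cite: DuquefrancoVillaflorloyola2023, Theorem 1.2 (proof)] -/
theorem socle_linearForm_mul_eq_zero_of_mem_sup (he : 1 ≤ e) (Z H : MvPolynomial (τ ⊕ τ) K)
    (hH : H ∈ Ideal.span (Set.range fun v : τ ⊕ τ => (X v : MvPolynomial (τ ⊕ τ) K) ^ e) ⊔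
      Ideal.span {C cP * fermatLinearCyclePolynomial c e}) :
    fermatSocleFunctional K (τ ⊕ τ) e ((X (Sum.inl i) - C (c i) * X (Sum.inr i)) * Z * H) = 0 := by
  obtain ⟨y, hy, z, hz, rfl⟩ := Submodule.mem_sup.mp hH
  obtain ⟨B, rfl⟩ := Ideal.mem_span_singleton'.mp hz
  rw [mul_add, map_add, socle_linearForm_mul_eq_zero_of_mem_span c e i he Z y hy,
    socle_linearForm_mul_eq_zero_of_mul_fakeP c e cP i he Z B, add_zero]

/-- **The value of `Φ` on `A·D·D'`** for `D = x_{2i}^{e−2}x^{μ₁}`, `D' = x_{2i+1}^{e−1}x^{μ₂}`,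
`Z = x^{W−μ₁−μ₂}` (`W = Σ_{j≠i}(e−1)[x_{2j+1}]`, `μ₁ + μ₂ ≤ W`, `e ≥ 2`): `Φ(A·D·D') = c_λ`.
[cite: DuquefrancoVillaflorloyola2023, Theorem 1.2 (proof)] -/
theorem socle_linearForm_mul_fakeCofactor_mul (he : 2 ≤ e) {μ₁ μ₂ : (τ ⊕ τ) →₀ ℕ}
    (hμ : μ₁ + μ₂ ≤ ∑ j ∈ univ.erase i, Finsupp.single (Sum.inr j) (e - 1)) :
    fermatSocleFunctional K (τ ⊕ τ) e
      ((X (Sum.inl i) - C (c i) * X (Sum.inr i)) *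
        monomial ((∑ j ∈ univ.erase i, Finsupp.single (Sum.inr j) (e - 1)) - (μ₁ + μ₂)) 1 *
        (fakeCofactor c e cP i * (X (Sum.inl i) ^ (e - 2) * monomial μ₁ 1) * (X (Sum.inr i) ^ (e - 1) * monomial μ₂ 1))) =
      cP := by
  have he1 : 1 ≤ e := by omega
  -- collect the monomials
  have hZ : monomial ((∑ j ∈ univ.erase i, Finsupp.single (Sum.inr j) (e - 1)) - (μ₁ + μ₂)) (1 : K) *
      (monomial μ₁ 1 * monomial μ₂ 1) = monomial (inrWeight e (univ.erase i)) 1 := by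
    rw [monomial_mul, monomial_mul, mul_one, mul_one, tsub_add_cancel_of_le hμ, inrWeight]
  have hL : ((X (Sum.inl i) : MvPolynomial (τ ⊕ τ) K) - C (c i) * X (Sum.inr i)) *
      (X (Sum.inl i) ^ (e - 2) * X (Sum.inr i) ^ (e - 1)) =
      monomial (Finsupp.single (Sum.inl i) (e - 1) + Finsupp.single (Sum.inr i) (e - 1)) 1 -
        monomial (Finsupp.single (Sum.inl i) (e - 2) + Finsupp.single (Sum.inr i) e) (c i) := by
    have e1 : (X (Sum.inl i) : MvPolynomial (τ ⊕ τ) K) * (X (Sum.inl i) ^ (e - 2) * X (Sum.inr i) ^ (e - 1)) =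
        monomial (Finsupp.single (Sum.inl i) (e - 1) + Finsupp.single (Sum.inr i) (e - 1)) 1 := by
      rw [← mul_assoc, ← pow_succ', show e - 2 + 1 = e - 1 by omega, X_pow_eq_monomial, X_pow_eq_monomial,
        monomial_mul, mul_one]
    have e2 : C (c i) * (X (Sum.inr i) : MvPolynomial (τ ⊕ τ) K) * (X (Sum.inl i) ^ (e - 2) * X (Sum.inr i) ^ (e - 1)) =
        monomial (Finsupp.single (Sum.inl i) (e - 2) + Finsupp.single (Sum.inr i) e) (c i) := by
      rw [show C (c i) * (X (Sum.inr i) : MvPolynomial (τ ⊕ τ) K) * (X (Sum.inl i) ^ (e - 2) * X (Sum.inr i) ^ (e - 1)) =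
          C (c i) * (X (Sum.inl i) ^ (e - 2) * (X (Sum.inr i) * X (Sum.inr i) ^ (e - 1))) by ring,
        ← pow_succ', show e - 1 + 1 = e by omega, X_pow_eq_monomial, X_pow_eq_monomial, monomial_mul, C_mul_monomial]
      simp
    rw [sub_mul, e1, e2]
  -- rearrange the argument of the functional
  have harr : (X (Sum.inl i) - C (c i) * X (Sum.inr i)) *
        monomial ((∑ j ∈ univ.erase i, Finsupp.single (Sum.inr j) (e - 1)) - (μ₁ + μ₂)) (1 : K) *
        (fakeCofactor c e cP i * (X (Sum.inl i) ^ (e - 2) * monomial μ₁ 1) * (X (Sum.inr i) ^ (e - 1) * monomial μ₂ 1)) =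
      ((X (Sum.inl i) - C (c i) * X (Sum.inr i)) * (X (Sum.inl i) ^ (e - 2) * X (Sum.inr i) ^ (e - 1))) *
        (C cP * ((monomial ((∑ j ∈ univ.erase i, Finsupp.single (Sum.inr j) (e - 1)) - (μ₁ + μ₂)) (1 : K) *
          (monomial μ₁ 1 * monomial μ₂ 1)) * ∏ j ∈ univ.erase i, fermatLinearCycleFactor c e j)) := by
    rw [fakeCofactor]; ring
  -- the two monomials against the socle exponent
  have hle1 : Finsupp.single (Sum.inl i) (e - 1) + Finsupp.single (Sum.inr i) (e - 1) ≤ fermatSocleExponent (τ ⊕ τ) e := by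
    intro v
    rw [Finsupp.add_apply, fermatSocleExponent_apply]
    rcases v with j | j
    · simp only [Finsupp.single_apply, Sum.inl.injEq, reduceCtorEq, ↓reduceIte, add_zero]
      split_ifs <;> omega
    · simp only [Finsupp.single_apply, Sum.inr.injEq, reduceCtorEq, ↓reduceIte, zero_add]
      split_ifs <;> omega
  have hnle2 : ¬ Finsupp.single (Sum.inl i) (e - 2) + Finsupp.single (Sum.inr i) e ≤ fermatSocleExponent (τ ⊕ τ) e := by
    intro hle
    have := hle (Sum.inr i)
    simp only [Finsupp.add_apply, Finsupp.single_apply, reduceCtorEq, ↓reduceIte, zero_add,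
      fermatSocleExponent_apply] at this
    omega
  rw [harr, hZ, monomial_inrWeight_mul_prod, hL, fermatSocleFunctional_apply, sub_mul, coeff_sub,
    coeff_monomial_mul', if_pos hle1, coeff_monomial_mul', if_neg hnle2, coeff_C_mul, fermatSocleExponent_sub_pair,
    coeff_pairTarget_prod c e he1]
  ring

/-- The exponents `μ₁` (degree `2`) and `μ₂` (degree `1`) on the odd variables of the other pairs, with
`μ₁ + μ₂ ≤ (e−1)` coordinatewise, exist exactly when `3 ≤ (#τ − 1)(e − 1)`, i.e. `d ≥ 2 + 6/n`
(`e ≥ 4`: one pair; `e = 3`: two pairs; `e = 2`: three pairs). [cite: DuquefrancoVillaflorloyola2023, Theorem 1.2 (hypothesis d ≥ 2 + 6/n)] -/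
theorem exists_exponents (he : 2 ≤ e) (hcard : 3 ≤ (Fintype.card τ - 1) * (e - 1)) :
    ∃ μ₁ μ₂ : (τ ⊕ τ) →₀ ℕ, μ₁.degree = 2 ∧ μ₂.degree = 1 ∧
      μ₁ + μ₂ ≤ ∑ j ∈ univ.erase i, Finsupp.single (Sum.inr j) (e - 1) := by
  have hS : (univ.erase i).card = Fintype.card τ - 1 := by
    rw [Finset.card_erase_of_mem (Finset.mem_univ i), Finset.card_univ]
  have hsub : ∀ T : Finset τ, T ⊆ univ.erase i →
      ∑ j ∈ T, Finsupp.single (Sum.inr j) (e - 1) ≤ ∑ j ∈ univ.erase i, (Finsupp.single (Sum.inr j) (e - 1) : (τ ⊕ τ) →₀ ℕ) :=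
    fun T hT => Finset.sum_le_sum_of_subset hT
  have hmem : ∀ j : τ, j ≠ i → j ∈ univ.erase i := fun j hj => Finset.mem_erase.mpr ⟨hj, Finset.mem_univ j⟩
  rcases Nat.lt_or_ge e 4 with hlt | h4
  · rcases Nat.lt_or_ge e 3 with hlt3 | h3
    · -- `e = 2`: three distinct pairs
      have he2 : e - 1 = 1 := by omega
      rw [he2] at hcard hsub ⊢
      have h3 : 2 < (univ.erase i).card := by rw [hS]; omega
      obtain ⟨j₀, hj₀, j₁, hj₁, j₂, hj₂, h01, h02, h12⟩ := Finset.two_lt_card.mp h3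
      refine ⟨Finsupp.single (Sum.inr j₀) 1 + Finsupp.single (Sum.inr j₁) 1, Finsupp.single (Sum.inr j₂) 1, ?_, ?_, ?_⟩
      · rw [map_add, Finsupp.degree_single, Finsupp.degree_single]
      · rw [Finsupp.degree_single]
      · refine le_trans (le_of_eq ?_) (hsub {j₀, j₁, j₂} ?_)
        · rw [Finset.sum_insert (by simp [h01, h02]), Finset.sum_pair h12, add_assoc]
        · intro j hj
          simp only [Finset.mem_insert, Finset.mem_singleton] at hj
          rcases hj with rfl | rfl | rfl <;> assumption
    · -- `e = 3`: two distinct pairs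
      have he3 : e - 1 = 2 := by omega
      rw [he3] at hcard hsub ⊢
      have h2 : 1 < (univ.erase i).card := by rw [hS]; omega
      obtain ⟨j₀, hj₀, j₁, hj₁, h01⟩ := Finset.one_lt_card.mp h2
      refine ⟨Finsupp.single (Sum.inr j₀) 2, Finsupp.single (Sum.inr j₁) 1, ?_, ?_, ?_⟩
      · rw [Finsupp.degree_single]
      · rw [Finsupp.degree_single]
      · refine le_trans ?_ (hsub {j₀, j₁} ?_)
        · rw [Finset.sum_pair h01]
          exact add_le_add le_rfl
            (show Finsupp.single (Sum.inr j₁) 1 ≤ Finsupp.single (Sum.inr j₁) 2 from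
              Finsupp.single_mono (by norm_num))
        · intro j hj
          simp only [Finset.mem_insert, Finset.mem_singleton] at hj
          rcases hj with rfl | rfl <;> assumption
  · -- `e ≥ 4`: one pair
    have h1 : 0 < (univ.erase i).card := by
      rw [hS]
      rcases Nat.eq_zero_or_pos (Fintype.card τ - 1) with h | h
      · rw [h, zero_mul] at hcard; omega
      · exact h
    obtain ⟨j₀, hj₀⟩ := Finset.card_pos.mp h1
    refine ⟨Finsupp.single (Sum.inr j₀) 2, Finsupp.single (Sum.inr j₀) 1, ?_, ?_, ?_⟩
    · rw [Finsupp.degree_single]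
    · rw [Finsupp.degree_single]
    · refine le_trans ?_ (hsub {j₀} (Finset.singleton_subset_iff.mpr hj₀))
      rw [Finset.sum_singleton, ← Finsupp.single_add]
      exact Finsupp.single_mono (by omega)

/-- **The implicit step of the proof of Thm. 1.2: `c_λ∏_{j≠i}P_{λ_j}·D·D' ∉ J^F + (P_λ)` for suitable forms
`D, D'` of degree `e = d − 1`**, whenever `c_λ ≠ 0`, `e ≥ 2` and `(#τ − 1)(e − 1) ≥ 3` (`⟺ d ≥ 2 + 6/n`,
`#τ = n/2 + 1`). No hypothesis on the `c_j` is needed. [cite: DuquefrancoVillaflorloyola2023, Theorem 1.2 (proof)] -/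
theorem fakeCofactor_mul_mul_not_mem (he : 2 ≤ e) (hcard : 3 ≤ (Fintype.card τ - 1) * (e - 1)) (hcP : cP ≠ 0) :
    ∃ D D' : MvPolynomial (τ ⊕ τ) K, D.IsHomogeneous e ∧ D'.IsHomogeneous e ∧
      fakeCofactor c e cP i * D * D' ∉
        Ideal.span (Set.range fun v : τ ⊕ τ => (X v : MvPolynomial (τ ⊕ τ) K) ^ e) ⊔
          Ideal.span {C cP * fermatLinearCyclePolynomial c e} := by
  obtain ⟨μ₁, μ₂, hd1, hd2, hμ⟩ := exists_exponents e i he hcard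
  refine ⟨X (Sum.inl i) ^ (e - 2) * monomial μ₁ 1, X (Sum.inr i) ^ (e - 1) * monomial μ₂ 1, ?_, ?_, fun hmem => ?_⟩
  · have := (isHomogeneous_X_pow (R := K) (Sum.inl i : τ ⊕ τ) (e - 2)).mul (isHomogeneous_monomial (R := K) (d := μ₁) 1 hd1)
    rwa [show e - 2 + 2 = e by omega] at this
  · have := (isHomogeneous_X_pow (R := K) (Sum.inr i : τ ⊕ τ) (e - 1)).mul (isHomogeneous_monomial (R := K) (d := μ₂) 1 hd2)
    rwa [show e - 1 + 1 = e by omega] at this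
  · have h0 := socle_linearForm_mul_eq_zero_of_mem_sup c e cP i (by omega)
      (monomial ((∑ j ∈ univ.erase i, Finsupp.single (Sum.inr j) (e - 1)) - (μ₁ + μ₂)) 1) _ hmem
    rw [socle_linearForm_mul_fakeCofactor_mul c e cP i he hμ] at h0
    exact hcP h0

/-- Hence **the value of Prop. 6.1 is non-zero in `S/(J^F + (P_λ))`** for these `G = L_i D`, `H = L_i D'` as soon as
`c_i^{e+1} + 1 ≠ 0` (and `d = e+1 ≠ 0` in `K`). [cite: DuquefrancoVillaflorloyola2023, Proposition 6.1 and Theorem 1.2 (proof)] -/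
theorem macleanForm_fakeLinearCycle_not_mem (he : 2 ≤ e) (hcard : 3 ≤ (Fintype.card τ - 1) * (e - 1))
    (hcP : cP ≠ 0) (hd : ((e + 1 : ℕ) : K) ≠ 0) (hci : c i ^ (e + 1) + 1 ≠ 0) :
    ∃ D D' : MvPolynomial (τ ⊕ τ) K, D.IsHomogeneous e ∧ D'.IsHomogeneous e ∧
      macleanForm ((X (Sum.inl i) - C (c i) * X (Sum.inr i)) * D) ((X (Sum.inl i) - C (c i) * X (Sum.inr i)) * D')
          (macleanLift c e cP i D) (macleanLift c e cP i D') ∉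
        Ideal.span (Set.range fun v : τ ⊕ τ => (X v : MvPolynomial (τ ⊕ τ) K) ^ e) ⊔
          Ideal.span {C cP * fermatLinearCyclePolynomial c e} := by
  obtain ⟨D, D', hD, hD', hnot⟩ := fakeCofactor_mul_mul_not_mem c e cP i he hcard hcP
  refine ⟨D, D', hD, hD', fun hmem => hnot ?_⟩
  rw [macleanForm_fakeLinearCycle] at hmem
  have hk : ((c i ^ (e + 1) + 1) / ((e + 1 : ℕ) : K)) ≠ 0 := div_ne_zero hci hd
  have hmem' : C ((c i ^ (e + 1) + 1) / ((e + 1 : ℕ) : K)) * (fakeCofactor c e cP i * D * D') ∈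
      Ideal.span (Set.range fun v : τ ⊕ τ => (X v : MvPolynomial (τ ⊕ τ) K) ^ e) ⊔
        Ideal.span {C cP * fermatLinearCyclePolynomial c e} := by
    have := Submodule.neg_mem _ hmem
    rwa [neg_mul, neg_neg] at this
  have : fakeCofactor c e cP i * D * D' =
      C ((c i ^ (e + 1) + 1) / ((e + 1 : ℕ) : K))⁻¹ *
        (C ((c i ^ (e + 1) + 1) / ((e + 1 : ℕ) : K)) * (fakeCofactor c e cP i * D * D')) := by
    rw [← mul_assoc, ← map_mul, inv_mul_cancel₀ hk, map_one, one_mul]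
  rw [this]
  exact Ideal.mul_mem_left _ _ hmem'

/-- **"`q_r = 0` ⇒ `c_{2i−2}^d + 1 = 0`" (proof of Thm. 1.2), algebraic form.** If, for every pair of forms
`D, D'` of degree `d − 1`, Maclean's expression `q_r(L_i D, L_i D')` (printed lifts) lies in `J^F + (P_λ)` — as it
does when the quadratic fundamental form of `V_λ` at the Fermat point vanishes, e.g. when `V_λ` is smooth and
reduced there [Thm. 6.1] — then `c_i^d = −1`. So a FAKE linear cycle (`c_i^d ≠ −1` for some `i`, Thm. 1.1) has a
non-reduced Hodge locus (`c_λ ≠ 0`, `d = e + 1 ≥ 3` invertible in `K`, `d ≥ 2 + 6/n`).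
[cite: DuquefrancoVillaflorloyola2023, Theorem 1.2 (proof)] [cite: DuquefrancoVillaflorloyola2023, Theorem 1.1] -/
theorem pow_eq_neg_one_of_forall_macleanForm_mem (he : 2 ≤ e) (hcard : 3 ≤ (Fintype.card τ - 1) * (e - 1))
    (hcP : cP ≠ 0) (hd : ((e + 1 : ℕ) : K) ≠ 0)
    (h : ∀ D D' : MvPolynomial (τ ⊕ τ) K, D.IsHomogeneous e → D'.IsHomogeneous e →
      macleanForm ((X (Sum.inl i) - C (c i) * X (Sum.inr i)) * D) ((X (Sum.inl i) - C (c i) * X (Sum.inr i)) * D')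
          (macleanLift c e cP i D) (macleanLift c e cP i D') ∈
        Ideal.span (Set.range fun v : τ ⊕ τ => (X v : MvPolynomial (τ ⊕ τ) K) ^ e) ⊔
          Ideal.span {C cP * fermatLinearCyclePolynomial c e}) :
    c i ^ (e + 1) = -1 := by
  by_contra hci
  have hci' : c i ^ (e + 1) + 1 ≠ 0 := fun h0 => hci (eq_neg_of_add_eq_zero_left h0)
  obtain ⟨D, D', hD, hD', hnot⟩ := macleanForm_fakeLinearCycle_not_mem c e cP i he hcard hcP hd hci'
  exact hnot (h D D' hD hD')

end Literature.AlgebraicGeometry.DuqueFrancoVillaflor2023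

end
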